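import Summits.CriticalPhenomena.SAWScalingLimit.Theorems.SAWLeftRightFKGFKGToTraversalBoundTamePresentation
import Literature.Topology.PlaneTopology.Rectangles
import HarnessLib

/-!
# Open rectangles are eventually tame (stub `eventuallyTame_of_carrier_eq_rect`)

Crux `SAWLeftRightFKG.FKGToTraversalBound` (stmt-CriticalPhenomena-1878), line `slit-necklace`, registered stub
`eventuallyTame_of_carrier_eq_rect`: a Dobrushin domain whose carrier is an axis-parallel open rectangle
`(p, q) × (r, s)` is `EventuallyTame` (`Theorems/SAWLeftRightFKGFKGToTraversalBoundSlitNecklaceDefs.lean`), with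
defect budget `N₀ = 0` and at EVERY mesh `δ > 0` — the simplest family of domains certified tame, so that the
landed necklace reduction of the line (which consumes `EventuallyTame D`) is not vacuous.

**Proof.**  Fix `δ > 0` and the tight lattice walls `x₀ = ⌊p/δ⌋`, `x₁ = ⌈q/δ⌉`, `y₀ = ⌊r/δ⌋`, `y₁ = ⌈s/δ⌉`.
The mesh vertices of `Ω = (p, q) × (r, s)` form the open box of sites `(x₀, x₁) × (y₀, y₁)`
(`mem_meshVertices_rect_iff`: `p < δ i ↔ ⌊p/δ⌋ < i`, `δ i < q ↔ i < ⌈q/δ⌉`); lattice neighbours among them are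
mesh neighbours (the segment lies in the convex set `Ω ⊆ closure Ω`, `meshGraph_adj_rect`); the mesh vertex graph
of a box of sites is preconnected (`reachable_of_box`: walk one lattice step at a time towards the target, each step
staying in the coordinatewise order-convex box), so the discrete domain is the whole box
(`Literature.Probability.Percolation.meshDomain_eq_meshVertices_of_preconnected`), and every site of the closed box
off the discrete domain is a wall site (trivial escape walk).  Hence the landed tool `tamePresentation_of_holeFree`
(`Theorems/SAWLeftRightFKGFKGToTraversalBoundTamePresentation.lean`) applies with the tight walls:
`TamePresentation Ω δ 0` for every `δ > 0` (`tamePresentation_rect`), and `EventuallyTame D` with `N₀ = 0`.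
No named fact; axioms are the standard three.
-/

noncomputable section

open Set Filter Topology
open Literature.Probability.LatticeModels Literature.Probability.RandomPlanarGeometry

namespace Summit.CriticalPhenomena.SAWScalingLimit.Theorems.FKGToTraversalBound.SlitNecklace

/-! ### Boxes of sites: one lattice step towards a target, preconnectedness -/

/-- One lattice step from `x` towards a different site `v`: the new site is coordinatewise between `x` and `v` and
strictly closer to `v` in `ℓ¹`. [folklore] -/
theorem exists_step_towards (x v : Site 2) (hxv : x ≠ v) :
    ∃ y : Site 2, (zdGraph 2).Adj x y ∧
      ((x 0 ≤ y 0 ∧ y 0 ≤ v 0) ∨ (v 0 ≤ y 0 ∧ y 0 ≤ x 0)) ∧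
      ((x 1 ≤ y 1 ∧ y 1 ≤ v 1) ∨ (v 1 ≤ y 1 ∧ y 1 ≤ x 1)) ∧
      (y 0 - v 0).natAbs + (y 1 - v 1).natAbs < (x 0 - v 0).natAbs + (x 1 - v 1).natAbs := by
  by_cases h0 : x 0 = v 0
  · have h1 : x 1 ≠ v 1 := by
      intro h1; apply hxv; funext i; fin_cases i
      · exact h0
      · exact h1
    rcases lt_or_gt_of_ne h1 with hlt | hgt
    · refine ⟨x + Pi.single 1 1, (zdGraph_adj_iff _ _).2 ⟨1, Or.inl rfl⟩, ?_, ?_, ?_⟩ <;>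
        simp only [Pi.add_apply, Pi.single_eq_same, Pi.single_eq_of_ne (zero_ne_one),
          add_zero] <;> omega
    · refine ⟨x - Pi.single 1 1, (zdGraph_adj_iff _ _).2 ⟨1, Or.inr (by simp)⟩, ?_, ?_, ?_⟩ <;>
        simp only [Pi.sub_apply, Pi.single_eq_same, Pi.single_eq_of_ne (zero_ne_one),
          sub_zero] <;> omega
  · rcases lt_or_gt_of_ne h0 with hlt | hgt
    · refine ⟨x + Pi.single 0 1, (zdGraph_adj_iff _ _).2 ⟨0, Or.inl rfl⟩, ?_, ?_, ?_⟩ <;>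
        simp only [Pi.add_apply, Pi.single_eq_same, Pi.single_eq_of_ne (one_ne_zero),
          add_zero] <;> omega
    · refine ⟨x - Pi.single 0 1, (zdGraph_adj_iff _ _).2 ⟨0, Or.inr (by simp)⟩, ?_, ?_, ?_⟩ <;>
        simp only [Pi.sub_apply, Pi.single_eq_same, Pi.single_eq_of_ne (one_ne_zero),
          sub_zero] <;> omega

/-- **Every site of a box is joined to every other one inside the mesh vertex graph**, when the mesh vertices form
the open box of sites `(x₀, x₁) × (y₀, y₁)` and lattice-adjacent mesh vertices are mesh-adjacent: induction on the
`ℓ¹` distance to the target, stepping towards it (`exists_step_towards`); each step stays in the box, which is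
coordinatewise order-convex. [folklore] -/
theorem reachable_of_box {Ω : Set ℂ} {δ : ℝ} {x₀ x₁ y₀ y₁ : ℤ}
    (hV : ∀ x : Site 2, x ∈ meshVertices Ω δ ↔ x₀ < x 0 ∧ x 0 < x₁ ∧ y₀ < x 1 ∧ x 1 < y₁)
    (hA : ∀ x y : Site 2, x ∈ meshVertices Ω δ → y ∈ meshVertices Ω δ → (zdGraph 2).Adj x y →
      (meshGraph Ω δ).Adj x y)
    (v : Site 2) (hv : v ∈ meshVertices Ω δ) :
    ∀ (n : ℕ) (x : Site 2) (hx : x ∈ meshVertices Ω δ),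
      (x 0 - v 0).natAbs + (x 1 - v 1).natAbs = n → (meshVertexGraph Ω δ).Reachable ⟨x, hx⟩ ⟨v, hv⟩ := by
  intro n
  induction n using Nat.strong_induction_on with
  | _ n ih =>
    intro x hx hn
    by_cases hxv : x = v
    · subst hxv; rfl
    obtain ⟨y, hadj, hy0, hy1, hlt⟩ := exists_step_towards x v hxv
    have hy : y ∈ meshVertices Ω δ := by
      have hx' := (hV x).1 hx
      have hv' := (hV v).1 hv
      exact (hV y).2 ⟨by omega, by omega, by omega, by omega⟩
    have h1 : (meshVertexGraph Ω δ).Adj ⟨x, hx⟩ ⟨y, hy⟩ := by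
      simp only [SimpleGraph.comap_adj, Function.Embedding.subtype_apply]
      exact hA x y hx hy hadj
    exact h1.reachable.trans (ih _ (hn ▸ hlt) y hy rfl)

/-- The mesh vertex graph of a box of sites (as in `reachable_of_box`) is preconnected. [folklore] -/
theorem preconnected_of_box {Ω : Set ℂ} {δ : ℝ} {x₀ x₁ y₀ y₁ : ℤ}
    (hV : ∀ x : Site 2, x ∈ meshVertices Ω δ ↔ x₀ < x 0 ∧ x 0 < x₁ ∧ y₀ < x 1 ∧ x 1 < y₁)
    (hA : ∀ x y : Site 2, x ∈ meshVertices Ω δ → y ∈ meshVertices Ω δ → (zdGraph 2).Adj x y →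
      (meshGraph Ω δ).Adj x y) :
    (meshVertexGraph Ω δ).Preconnected := fun u w =>
  reachable_of_box hV hA w.1 w.2 _ u.1 u.2 rfl

/-! ### Open rectangles at mesh `δ > 0` -/

variable {Ω : Set ℂ} {p q r s : ℝ}

/-- An axis-parallel open rectangle is convex (intersection of four open half-planes). [folklore] -/
theorem convex_rect (hΩ : Ω = {z : ℂ | p < z.re ∧ z.re < q ∧ r < z.im ∧ z.im < s}) : Convex ℝ Ω := by
  have h : Ω = {z : ℂ | p < z.re} ∩ ({z : ℂ | z.re < q} ∩ ({z : ℂ | r < z.im} ∩ {z : ℂ | z.im < s})) := by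
    rw [hΩ]; ext z; simp only [Set.mem_inter_iff, Set.mem_setOf_eq]
  rw [h]
  exact (convex_halfSpace_re_gt _).inter ((convex_halfSpace_re_lt _).inter
    ((convex_halfSpace_im_gt _).inter (convex_halfSpace_im_lt _)))

/-- Lattice neighbours among the mesh vertices of an open rectangle are mesh neighbours: the segment joining the
two mesh points lies in the convex rectangle, hence in its closure. [folklore] -/
theorem meshGraph_adj_rect (hΩ : Ω = {z : ℂ | p < z.re ∧ z.re < q ∧ r < z.im ∧ z.im < s}) {δ : ℝ}
    (x y : Site 2) (hx : x ∈ meshVertices Ω δ) (hy : y ∈ meshVertices Ω δ) (h : (zdGraph 2).Adj x y) :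
    (meshGraph Ω δ).Adj x y :=
  meshGraph_adj_iff.2 ⟨h, ((convex_rect hΩ).segment_subset hx hy).trans subset_closure⟩

/-- **The mesh vertices of the open rectangle `(p, q) × (r, s)` at mesh `δ > 0`** form the open box of sites
`(⌊p/δ⌋, ⌈q/δ⌉) × (⌊r/δ⌋, ⌈s/δ⌉)`: `p < δ i ↔ p/δ < i ↔ ⌊p/δ⌋ < i` and `δ i < q ↔ i < q/δ ↔ i < ⌈q/δ⌉`.
[folklore] -/
theorem mem_meshVertices_rect_iff (hΩ : Ω = {z : ℂ | p < z.re ∧ z.re < q ∧ r < z.im ∧ z.im < s}) {δ : ℝ}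
    (hδ : 0 < δ) (x : Site 2) :
    x ∈ meshVertices Ω δ ↔ ⌊p / δ⌋ < x 0 ∧ x 0 < ⌈q / δ⌉ ∧ ⌊r / δ⌋ < x 1 ∧ x 1 < ⌈s / δ⌉ := by
  subst hΩ
  rw [mem_meshVertices_iff, Set.mem_setOf_eq, meshPoint_re, meshPoint_im, Int.floor_lt, Int.lt_ceil,
    Int.floor_lt, Int.lt_ceil, div_lt_iff₀' hδ, lt_div_iff₀' hδ, div_lt_iff₀' hδ, lt_div_iff₀' hδ]

/-- **The discrete domain of an open rectangle is the whole set of its mesh vertices** at every mesh `δ > 0`: the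
mesh vertex graph of the box is preconnected (`preconnected_of_box`), so there is a single component
(`meshDomain_eq_meshVertices_of_preconnected`). [folklore] -/
theorem meshDomain_rect (hΩ : Ω = {z : ℂ | p < z.re ∧ z.re < q ∧ r < z.im ∧ z.im < s}) {δ : ℝ}
    (hδ : 0 < δ) : meshDomain Ω δ = meshVertices Ω δ :=
  Literature.Probability.Percolation.meshDomain_eq_meshVertices_of_preconnected
    (preconnected_of_box (mem_meshVertices_rect_iff hΩ hδ) (meshGraph_adj_rect hΩ))

/-- **Open rectangles are tame with no defect at every mesh `δ > 0`**: with the tight lattice walls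
`⌊p/δ⌋, ⌈q/δ⌉, ⌊r/δ⌋, ⌈s/δ⌉` the discrete domain is the open box of sites (`meshDomain_rect`,
`mem_meshVertices_rect_iff`), it is induced (`meshGraph_adj_rect`), and every site of the closed box off it is a
wall site, so `tamePresentation_of_holeFree` applies. [folklore] -/
theorem tamePresentation_rect (hΩ : Ω = {z : ℂ | p < z.re ∧ z.re < q ∧ r < z.im ∧ z.im < s}) {δ : ℝ}
    (hδ : 0 < δ) : TamePresentation Ω δ 0 := by
  have hV := mem_meshVertices_rect_iff hΩ hδ
  have hD := meshDomain_rect hΩ hδ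
  refine tamePresentation_of_holeFree Ω δ ⌊p / δ⌋ ⌈q / δ⌉ ⌊r / δ⌋ ⌈s / δ⌉ hδ
    (fun x hx => (hV x).1 (meshDomain_subset_meshVertices _ _ hx))
    (fun x hx y hy h => meshGraph_adj_rect hΩ x y (meshDomain_subset_meshVertices _ _ hx)
      (meshDomain_subset_meshVertices _ _ hy) h)
    (fun k h1 h2 h3 h4 hk => ⟨k, SimpleGraph.Walk.nil, ?_, fun z hz => ?_⟩)
  · rw [hD, hV] at hk
    omega
  · rw [SimpleGraph.Walk.support_nil, List.mem_singleton] at hz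
    subst hz
    exact ⟨hk, h1, h2, h3, h4⟩

/-! ### The registered stub -/

/-- **Registered stub `eventuallyTame_of_carrier_eq_rect`** (line `slit-necklace`, crux stmt-CriticalPhenomena-1878).
A Dobrushin domain whose carrier is an axis-parallel open rectangle `(p, q) × (r, s)` is eventually tame, with
defect budget `N₀ = 0`: at every mesh `δ > 0` its discretisation `Ω_δ` is the graph of an r2 carrier with no defect
(`tamePresentation_rect`), in particular eventually as `δ → 0⁺`. [folklore] -/
theorem eventuallyTame_of_carrier_eq_rect : ∀ (D : DobrushinDomain) (p q r s : ℝ),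
    D.carrier = {z : ℂ | p < z.re ∧ z.re < q ∧ r < z.im ∧ z.im < s} → EventuallyTame D :=
  fun _ _ _ _ _ hD => ⟨0, eventually_nhdsWithin_of_forall fun _ hδ => tamePresentation_rect hD hδ⟩

/-- **Non-vacuity.**  For all `p < q` and `r < s` some Dobrushin domain has carrier the open rectangle
`(p, q) × (r, s)` — the Jordan domain `Literature.Topology.PlaneTopology.rect` (carrier `Ioo p q ×ℂ Ioo r s`) with
the two marks of `DobrushinDomain.unitDisc` — and it is eventually tame (`eventuallyTame_of_carrier_eq_rect`).
[folklore] -/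
theorem exists_dobrushinDomain_rect_eventuallyTame : ∀ p q r s : ℝ, p < q → r < s →
    ∃ D : DobrushinDomain,
      D.carrier = {z : ℂ | p < z.re ∧ z.re < q ∧ r < z.im ∧ z.im < s} ∧ EventuallyTame D := by
  intro p q r s hpq hrs
  have hc : (Literature.Topology.PlaneTopology.rect hpq hrs).carrier =
      {z : ℂ | p < z.re ∧ z.re < q ∧ r < z.im ∧ z.im < s} :=
    Set.ext fun z => by
      simp only [Literature.Topology.PlaneTopology.rect_carrier, Complex.mem_reProdIm, Set.mem_Ioo,
        Set.mem_setOf_eq, and_assoc]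
  exact ⟨⟨Literature.Topology.PlaneTopology.rect hpq hrs, DobrushinDomain.unitDisc.mark,
      DobrushinDomain.unitDisc.strictMono_mark, DobrushinDomain.unitDisc.mark_mem⟩, hc,
    eventuallyTame_of_carrier_eq_rect _ p q r s hc⟩

end Summit.CriticalPhenomena.SAWScalingLimit.Theorems.FKGToTraversalBound.SlitNecklace

end
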